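import Mathlib
import HarnessLib
import Literature.Probability.MarkovChains.PseudoMarginalVarianceOrder
import Literature.Probability.MarkovChains.AugmentedKernelGap

/-!
# Ordering two pseudo-marginal algorithms: the right spectral gaps
# (Andrieu–Vihola 2016, Theorem 10 (d))

HONEST FRAMING: exact (Metropolis-corrected) sampling algorithms for lattice gauge theory;
figures of merit are autocorrelation/cost numbers at stated couplings and volumes; no
continuum-physics claim.

Setting (finite form; the vocabulary of `PseudoMarginal.lean`, `PseudoMarginalAcceptance.lean`,
`PeskunOrdering.lean`, `PseudoMarginalVarianceOrder.lean`, `AugmentedKernelGap.lean`).  `X` finite,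
`π > 0` a probability vector, `T ≥ 0` a proposal matrix with row sums `≤ 1`, two positive unbiased
estimators `f₁ : X → Ξ₁ → ℝ` (noise law `g₁ > 0`) and `f₂ : X → Ξ₂ → ℝ` (noise law `g₂ > 0`) of
`π`, pseudo-marginal chains `P̃ᵢ = kernel T fᵢ gᵢ` with targets `π̃ᵢ = target fᵢ gᵢ`.

THE RESULT.  "let `P̃₁` and `P̃₂` be two pseudo-marginal approximations of `P` … with distinct
weight distributions satisfying `{Q_x^{(1)}} ≤cx {Q_x^{(2)}}`.  Then … (d) the spectral gaps
satisfy `Gap_R(P̃₁) ≥ min{Gap_R(P̃₂), 1 − ρ̃₂^*}`, where `ρ̃₂^* := π̃₂-ess sup_{(x,w)} ρ̃₂(x,w)`, the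
essential supremum of the rejection probability corresponding to `P̃₂`"
[cite: AndrieuVihola2016, Theorem 10 (d)].  PROOF AS PRINTED [cite: AndrieuVihola2016, §5 (proof
of Theorem 10) and Theorem 22 (d)]: with the martingale coupling `R_x` of the two weight laws
(Strassen; tree `IsCxLE.exists_isMartingaleCoupling`) one forms the augmented chain `P̆₂` on
`X × ℝ₊²` — move with the acceptance part of `P̃₂`, redraw the less noisy weight from the
conditional law `K₁(y, u; ·)` of `R_y` given the noisier one, hold otherwise — which is exactly the
`Π_ν` of [cite: AndrieuVihola2016, Appendix Lemma 45] for `Π = P̃₂`, `ν = K₁` ("In both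
situations, we are now in the setting of Lemma 45 … with `E = X × (0,∞)` and `S = (0,∞)`"); then
`Gap_R(P̃₁) ≥ Gap_R(P̆₂)` (Theorem 22 (d): a test function `ψ(x,w)` of `P̃₁` lifts to `P̆₂` with
the same `π̆`-moments, and `𝓔_{P̆₂}(ψ) ≤ 𝓔_{P̆₁}(ψ) = 𝓔_{P̃₁}(ψ)` by the Jensen step
"`min{w, r(x,y)u} ≥ ∫∫ min{v, r(x,y)t}`" of Theorem 22 (b)) and
`Gap_R(P̆₂) ≥ min{Gap_R(P̃₂), 1 − ρ̃₂^*}` (Lemma 45 (c)).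

Finite form proved here:

* `mhHold T π x = 1 − Σ_y mhRate T π x y` — the REJECTION (holding) probability of a
  Metropolis–Hastings kernel, and `mhKernel_eq_rate_add_diagonal`:
  `mhKernel T π = mhRate T π + diagonal (mhHold T π)` (the split `Π = p + δ r` of Lemma 45 with
  `p` the acceptance part, self-proposals included, so that `r` is exactly the rejection
  probability `ρ̃`).
* `PseudoMarginal.condLaw r g₂ (y, ξ₂) ξ₁ = r y ξ₁ ξ₂ / g₂ ξ₂` — the conditional law `K₁(y, u; dw)`.
* `PseudoMarginal.dirichletForm_breve_lift` — the Dirichlet form of `P̆₂ = (P̃₂)_{K₁}` on a lifted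
  test function `ψ(x, ξ₁)`:
  `½ Σ_{x,y} Σ_{ξ₁,ξ₁'} [Σ_{ξ₂,ξ₂'} r_x(ξ₁,ξ₂) r_y(ξ₁',ξ₂') min(f₂xξ₂ Txy, f₂yξ₂' Tyx)] (ψ(x,ξ₁) − ψ(y,ξ₁'))²`;
  `PseudoMarginal.dirichletForm_breve_lift_le` — `≤ 𝓔_{P̃₁}(ψ)` (Theorem 22 (b)/(d), via the tree's
  `sum_coupling_min_le`).
* **`PseudoMarginal.min_spectralGapR_le_dirichletForm_of_coupling`** — for every `π̃₁`-admissible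
  `ψ` (mean zero, unit norm): `min{Gap_R(P̃₂), 1 − ρ} ≤ 𝓔_{P̃₁}(ψ)` whenever the rejection
  probabilities of `P̃₂` are `≤ ρ`; hence **`PseudoMarginal.spectralGapR_mono_of_coupling`** and,
  by Strassen's theorem, **`PseudoMarginal.spectralGapR_mono_of_isCxLE`** —
  [cite: AndrieuVihola2016, Theorem 10 (d)] in finite form:
  `min{Gap_R(P̃₂), 1 − ρ} ≤ Gap_R(P̃₁)`, provided `X × Ξ₁` carries at least one admissible test
  function (on a one-point space the tree's `spectralGapR` is `sInf ∅ = 0`, not `+∞`).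
  No irreducibility is needed.

Not here: item (e) / Remark 46 (`π` not concentrated on points), the essential supremum itself (any
uniform bound `ρ` on the rejection probabilities is allowed instead), general state spaces.
TODO(general form).

Context: cell pub-lqcd (venture LatticeQCDFlow), R2-SCOPE.md §3 E2 D2 / E6 / §4 C-PM: with Theorem
10 (a) (`pmAccept_mono_of_isCxLE`), (b) (`dirichletForm_lift_mono_of_isCxLE`), (c)
(`asympVar_lift_mono_of_isCxLE`) already in the tree, this file completes items (a)–(d) of
[AndrieuVihola2016, Theorem 10] in finite form: convex-ordered (e.g. fewer-draw vs more-draw)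
pseudofermion estimators give ordered acceptance, Dirichlet forms, asymptotic variances, and — up to
the rejection ceiling `1 − ρ̃₂^*` — ordered spectral gaps.

## References
* [AndrieuVihola2016] C. Andrieu, M. Vihola, Establishing some order amongst exact approximations of
  MCMCs, Ann. Appl. Probab. 26 (2016) 2661–2696, arXiv:1404.6909; Theorem 10 (d); §5 Lemma 18,
  Lemma 20, Corollary 21, Theorem 22 (b), (d) and the proof of Theorem 10; Appendix Lemma 45.
-/

namespace Literature.Probability.MarkovChains

open Finset Matrix

variable {X : Type*} [Fintype X] [DecidableEq X]

/-! ## The acceptance/rejection split of a Metropolis–Hastings kernel -/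

/-- The REJECTION (holding) probability of the Metropolis–Hastings kernel at `x`:
`ρ(x) = 1 − Σ_y T x y · min{1, π y T y x / (π x T x y)}` (self-proposals count as accepted).
[cite: AndrieuVihola2016, §1 (the rejection probability `ρ̃(x,w)` in the display defining `P̃`)] -/
noncomputable def mhHold (T : X → X → ℝ) (π : X → ℝ) (x : X) : ℝ := 1 - ∑ y, mhRate T π x y

omit [DecidableEq X] in
/-- `Σ_y mhRate x y + ρ(x) = 1`. [cite: AndrieuVihola2016, §1 (`P̃(x,w;·)` is a probability)] -/
theorem sum_mhRate_add_mhHold (T : X → X → ℝ) (π : X → ℝ) (x : X) :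
    ∑ y, mhRate T π x y + mhHold T π x = 1 := by
  unfold mhHold; ring

omit [DecidableEq X] in
/-- `ρ(x) ≥ 0` when `T ≥ 0` has row sums `≤ 1` (the rates are at most the proposal
probabilities; `T` itself need not be non-negative for this). [cite: AndrieuVihola2016, §1
(`ρ̃(x,w) ∈ [0,1]`)] -/
theorem mhHold_nonneg {T : X → X → ℝ} (hTrow : ∀ x, ∑ y, T x y ≤ 1)
    (π : X → ℝ) (x : X) : 0 ≤ mhHold T π x := by
  classical
  unfold mhHold
  have h : ∑ y, mhRate T π x y ≤ ∑ y, T x y := sum_le_sum fun y _ => mhRate_le T π x y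
  linarith [hTrow x]

/-- **The split `Π = p + δ r` with `p` the acceptance part**:
`mhKernel T π = mhRate T π + diagonal (mhHold T π)` as matrices.
[cite: AndrieuVihola2016, Appendix Lemma 45 (the form `Π(x,dy) = p(x,dy) + δ_x(dy) r(x)`), §5
(proof of Theorem 10: "the sub-probability kernels corresponding to the acceptance parts")] -/
theorem mhKernel_eq_rate_add_diagonal (T : X → X → ℝ) (π : X → ℝ) :
    (mhKernel T π : Matrix X X ℝ) = (Matrix.of (mhRate T π) : Matrix X X ℝ) + diagonal (mhHold T π) := by
  ext x y
  rw [Matrix.add_apply, of_apply]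
  by_cases h : y = x
  · subst h
    rw [mhKernel_self, diagonal_apply_eq, mhHold, ← add_sum_erase _ _ (mem_univ y)]
    ring
  · rw [mhKernel_of_ne h, diagonal_apply_ne _ (Ne.symm h), add_zero]

omit [Fintype X] [DecidableEq X] in
/-- Detailed balance of the full rate matrix (diagonal included): `π x · mhRate x y` is symmetric.
[cite: AndrieuVihola2016, Appendix Proposition 44 / Lemma 45 (a) (reversibility of the acceptance
part)] -/
theorem mhRate_detailedBalance {π : X → ℝ} (hπ : ∀ x, 0 < π x) (T : X → X → ℝ) :
    DetailedBalance π (Matrix.of (mhRate T π) : Matrix X X ℝ) := by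
  intro x y
  rw [of_apply, of_apply, mul_mhRate hπ, mul_mhRate hπ, min_comm]

namespace PseudoMarginal

section SpectralGap

variable {Ξ₁ Ξ₂ : Type*} [Fintype Ξ₁] [DecidableEq Ξ₁] [Fintype Ξ₂] [DecidableEq Ξ₂]

/-- The conditional law `K₁(y, u; dw)` of the less noisy label given the noisier one under the
coupling `R_y`: `condLaw r g₂ (y, ξ₂) ξ₁ = r y ξ₁ ξ₂ / g₂ ξ₂`. [cite: AndrieuVihola2016, §5 (proof of
Theorem 10: "`R_x(dw × du) = Q_x^{(2)}(du) K₁(x, u; dw)`")] -/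
noncomputable def condLaw (r : X → Ξ₁ → Ξ₂ → ℝ) (g₂ : Ξ₂ → ℝ) : X × Ξ₂ → Ξ₁ → ℝ :=
  fun z ξ₁ => r z.1 ξ₁ z.2 / g₂ z.2

omit [Fintype X] [DecidableEq X] [Fintype Ξ₁] [DecidableEq Ξ₁] [Fintype Ξ₂] [DecidableEq Ξ₂] in
/-- Unfolding `K₁`. [cite: AndrieuVihola2016, §5 (proof of Theorem 10)] -/
theorem condLaw_apply (r : X → Ξ₁ → Ξ₂ → ℝ) (g₂ : Ξ₂ → ℝ) (z : X × Ξ₂) (ξ₁ : Ξ₁) :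
    condLaw r g₂ z ξ₁ = r z.1 ξ₁ z.2 / g₂ z.2 := rfl

omit [Fintype X] [DecidableEq X] [DecidableEq Ξ₁] [DecidableEq Ξ₂] in
/-- `K₁(y, u; ·)` is a probability law (second marginal of the coupling).
[cite: AndrieuVihola2016, §5 Lemma 18 (a)] -/
theorem sum_condLaw {g₁ : Ξ₁ → ℝ} {w₁ : X → Ξ₁ → ℝ} {g₂ : Ξ₂ → ℝ} {w₂ : X → Ξ₂ → ℝ}
    {r : X → Ξ₁ → Ξ₂ → ℝ} (hR : ∀ x, IsMartingaleCoupling g₁ (w₁ x) g₂ (w₂ x) (r x))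
    (hg₂ : ∀ ξ, 0 < g₂ ξ) (z : X × Ξ₂) : ∑ ξ₁, condLaw r g₂ z ξ₁ = 1 := by
  simp only [condLaw_apply, ← sum_div, (hR z.1).snd z.2, div_self (hg₂ z.2).ne']

omit [Fintype Ξ₁] [DecidableEq X] [DecidableEq Ξ₁] [Fintype Ξ₂] [DecidableEq Ξ₂] [Fintype X] in
/-- The augmented weight `π̆((x,ξ₂),ξ₁) = π̃₂(x,ξ₂) K₁(x,ξ₂;ξ₁) = f₂ x ξ₂ · r x ξ₁ ξ₂`.
[cite: AndrieuVihola2016, §5 Lemma 20 (`π̆(dx × dw × dv) = π(dx) R_x(dw × dv) v`)] -/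
theorem augWeight_target_condLaw {f₂ : X → Ξ₂ → ℝ} {g₂ : Ξ₂ → ℝ} (hg₂ : ∀ ξ, 0 < g₂ ξ)
    (r : X → Ξ₁ → Ξ₂ → ℝ) (a : (X × Ξ₂) × Ξ₁) :
    augWeight (target f₂ g₂) (condLaw r g₂) a = f₂ a.1.1 a.1.2 * r a.1.1 a.2 a.1.2 := by
  rw [augWeight_apply, condLaw_apply]
  unfold target
  field_simp [(hg₂ a.1.2).ne']

omit [DecidableEq X] [DecidableEq Ξ₁] [DecidableEq Ξ₂] in
/-- **The augmented weight has the `π̃₁`-moments of lifted functions**: for any `G : X × Ξ₁ → ℝ`,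
`Σ_{((x,ξ₂),ξ₁)} π̆ · G(x,ξ₁) = Σ_{(x,ξ₁)} π̃₁(x,ξ₁) G(x,ξ₁)` (the martingale property
`Σ_{ξ₂} r x ξ₁ ξ₂ f₂ x ξ₂ = g₁ ξ₁ f₁ x ξ₁`). [cite: AndrieuVihola2016, §5 Lemma 20 and Corollary 21
(`π̆(g₁) = π̃₁(f₁)`)] -/
theorem sum_augWeight_lift {f₁ : X → Ξ₁ → ℝ} {g₁ : Ξ₁ → ℝ} {f₂ : X → Ξ₂ → ℝ} {g₂ : Ξ₂ → ℝ}
    {π : X → ℝ} {r : X → Ξ₁ → Ξ₂ → ℝ} (hπ : ∀ x, 0 < π x) (hg₂ : ∀ ξ, 0 < g₂ ξ)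
    (hR : ∀ x, IsMartingaleCoupling g₁ (fun ξ => f₁ x ξ / π x) g₂ (fun ξ => f₂ x ξ / π x) (r x))
    (G : X × Ξ₁ → ℝ) :
    ∑ a, augWeight (target f₂ g₂) (condLaw r g₂) a * G (a.1.1, a.2) =
      ∑ z, target f₁ g₁ z * G z := by
  simp only [augWeight_target_condLaw hg₂, Fintype.sum_prod_type]
  refine sum_congr rfl fun x _ => ?_
  rw [sum_comm]
  refine sum_congr rfl fun ξ₁ _ => ?_
  unfold target
  calc ∑ ξ₂, f₂ x ξ₂ * r x ξ₁ ξ₂ * G (x, ξ₁) = (∑ ξ₂, r x ξ₁ ξ₂ * f₂ x ξ₂) * G (x, ξ₁) := by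
        rw [sum_mul]; exact sum_congr rfl fun ξ₂ _ => by ring
    _ = g₁ ξ₁ * f₁ x ξ₁ * G (x, ξ₁) := by rw [(hR x).sum_mul_est (hπ x)]

/-- Re-indexing of a pair of augmented states `(((x,ξ₂),ξ₁),((y,ξ₂'),ξ₁'))` as
`(x,(y,((ξ₁,ξ₁'),(ξ₂,ξ₂'))))` (private bookkeeping for the six-fold sum). [folklore] -/
private def breveIndexEquiv (X Ξ₁ Ξ₂ : Type*) :
    ((X × Ξ₂) × Ξ₁) × ((X × Ξ₂) × Ξ₁) ≃ X × (X × ((Ξ₁ × Ξ₁) × (Ξ₂ × Ξ₂))) where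
  toFun p := (p.1.1.1, (p.2.1.1, ((p.1.2, p.2.2), (p.1.1.2, p.2.1.2))))
  invFun q := (((q.1, q.2.2.2.1), q.2.2.1.1), ((q.2.1, q.2.2.2.2), q.2.2.1.2))
  left_inv := fun ⟨⟨⟨_, _⟩, _⟩, ⟨⟨_, _⟩, _⟩⟩ => rfl
  right_inv := fun ⟨_, ⟨_, ⟨⟨_, _⟩, ⟨_, _⟩⟩⟩⟩ => rfl

/-- **The Dirichlet form of the augmented chain `P̆₂ = (P̃₂)_{K₁}` on a lifted test function** of
`(x, ξ₁)`: `𝓔_{P̆₂}(ψ̆) = ½ Σ_x Σ_y Σ_{(ξ₁,ξ₁')} [Σ_{(ξ₂,ξ₂')} r x ξ₁ ξ₂ · r y ξ₁' ξ₂' ·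
min(f₂ x ξ₂ T x y, f₂ y ξ₂' T y x)] (ψ(x,ξ₁) − ψ(y,ξ₁'))²` — the holding terms vanish and
`π̃₂(x,ξ₂) K₁ · p̃₂ · K₁ = r_x r_y min{…}` by `target_mul_mhRate`. [cite: AndrieuVihola2016, §5
(proof of Theorem 10, the display for `P̆₂`; Theorem 22 (b))] -/
theorem dirichletForm_breve_lift {f₂ : X → Ξ₂ → ℝ} {g₂ : Ξ₂ → ℝ} (hf₂ : ∀ x ξ, 0 < f₂ x ξ)
    (hg₂ : ∀ ξ, 0 < g₂ ξ) (T : X → X → ℝ) (r : X → Ξ₁ → Ξ₂ → ℝ) (ψ : X × Ξ₁ → ℝ) :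
    dirichletForm (augWeight (target f₂ g₂) (condLaw r g₂))
        (augKernel (Matrix.of (mhRate (proposal T g₂) (target f₂ g₂)))
          (mhHold (proposal T g₂) (target f₂ g₂)) (condLaw r g₂))
        (fun a => ψ (a.1.1, a.2)) =
      (1 / 2) * ∑ x, ∑ y, ∑ q : Ξ₁ × Ξ₁,
        (∑ s : Ξ₂ × Ξ₂, r x q.1 s.1 * r y q.2 s.2 * min (f₂ x s.1 * T x y) (f₂ y s.2 * T y x)) *
          (ψ (x, q.1) - ψ (y, q.2)) ^ 2 := by
  unfold dirichletForm
  congr 1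
  -- termwise: holding terms vanish, moving terms are `r_x r_y min{…} (ψ − ψ)²`
  have hterm : ∀ a b : (X × Ξ₂) × Ξ₁,
      augWeight (target f₂ g₂) (condLaw r g₂) a *
          augKernel (Matrix.of (mhRate (proposal T g₂) (target f₂ g₂)))
            (mhHold (proposal T g₂) (target f₂ g₂)) (condLaw r g₂) a b *
          (ψ (a.1.1, a.2) - ψ (b.1.1, b.2)) ^ 2 =
        r a.1.1 a.2 a.1.2 * r b.1.1 b.2 b.1.2 *
          min (f₂ a.1.1 a.1.2 * T a.1.1 b.1.1) (f₂ b.1.1 b.1.2 * T b.1.1 a.1.1) *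
          (ψ (a.1.1, a.2) - ψ (b.1.1, b.2)) ^ 2 := by
    rintro ⟨⟨x, ξ₂⟩, ξ₁⟩ ⟨⟨y, ξ₂'⟩, ξ₁'⟩
    dsimp only
    by_cases hab : ((x, ξ₂), ξ₁) = ((y, ξ₂'), ξ₁')
    · simp only [Prod.mk.injEq] at hab
      obtain ⟨⟨rfl, rfl⟩, rfl⟩ := hab
      simp
    · rw [augKernel_apply, if_neg hab, add_zero, augWeight_apply, of_apply, condLaw_apply,
        condLaw_apply]
      dsimp only
      have key := target_mul_mhRate hf₂ hg₂ T x y ξ₂ ξ₂'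
      have hg := (hg₂ ξ₂).ne'
      have hg' := (hg₂ ξ₂').ne'
      have e1 : target f₂ g₂ (x, ξ₂) * (r x ξ₁ ξ₂ / g₂ ξ₂) *
          (mhRate (proposal T g₂) (target f₂ g₂) (x, ξ₂) (y, ξ₂') * (r y ξ₁' ξ₂' / g₂ ξ₂')) =
          (target f₂ g₂ (x, ξ₂) * mhRate (proposal T g₂) (target f₂ g₂) (x, ξ₂) (y, ξ₂')) *
            (r x ξ₁ ξ₂ * r y ξ₁' ξ₂') / (g₂ ξ₂ * g₂ ξ₂') := by
        field_simp
      rw [e1, key]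
      field_simp
  rw [← Fintype.sum_prod_type']
  rw [Fintype.sum_equiv (breveIndexEquiv X Ξ₁ Ξ₂) _
    (fun q => r q.1 q.2.2.1.1 q.2.2.2.1 * r q.2.1 q.2.2.1.2 q.2.2.2.2 *
      min (f₂ q.1 q.2.2.2.1 * T q.1 q.2.1) (f₂ q.2.1 q.2.2.2.2 * T q.2.1 q.1) *
      (ψ (q.1, q.2.2.1.1) - ψ (q.2.1, q.2.2.1.2)) ^ 2)
    (fun ab => by rw [hterm]; rfl)]
  simp only [Fintype.sum_prod_type, Finset.sum_mul]

/-- **Theorem 22 (b)/(d), finite form: `𝓔_{P̆₂}(ψ̆) ≤ 𝓔_{P̃₁}(ψ)`** for every test function `ψ` of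
`(x, ξ₁)` — termwise the printed Jensen step "`∫∫ R_x R_y min{v, r(x,y)t} ≤ min{w, r(x,y)u}`"
(tree `sum_coupling_min_le`), with `𝓔_{P̃₁}` in flow form (`dirichletForm_kernel_eq`).
[cite: AndrieuVihola2016, §5 Theorem 22 (b) and its use in (d) ("`𝓔_{P̆₁}(ψᵢ) = 𝓔_{P̃₁}(ψᵢ)` …
`Gap_R(P̆₂) ≤ liminf 𝓔_{P̆₂}(ψᵢ) ≤ liminf 𝓔_{P̆₁}(ψᵢ)`")] -/
theorem dirichletForm_breve_lift_le {f₁ : X → Ξ₁ → ℝ} {g₁ : Ξ₁ → ℝ} {f₂ : X → Ξ₂ → ℝ}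
    {g₂ : Ξ₂ → ℝ} {π : X → ℝ} {T : X → X → ℝ} {r : X → Ξ₁ → Ξ₂ → ℝ}
    (hf₁ : ∀ x ξ, 0 < f₁ x ξ) (hg₁ : ∀ ξ, 0 < g₁ ξ) (hf₂ : ∀ x ξ, 0 < f₂ x ξ)
    (hg₂ : ∀ ξ, 0 < g₂ ξ) (hπ : ∀ x, 0 < π x)
    (hR : ∀ x, IsMartingaleCoupling g₁ (fun ξ => f₁ x ξ / π x) g₂ (fun ξ => f₂ x ξ / π x) (r x))
    (ψ : X × Ξ₁ → ℝ) :
    dirichletForm (augWeight (target f₂ g₂) (condLaw r g₂))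
        (augKernel (Matrix.of (mhRate (proposal T g₂) (target f₂ g₂)))
          (mhHold (proposal T g₂) (target f₂ g₂)) (condLaw r g₂))
        (fun a => ψ (a.1.1, a.2)) ≤
      dirichletForm (target f₁ g₁) (kernel T f₁ g₁) ψ := by
  rw [dirichletForm_breve_lift hf₂ hg₂ T r ψ, dirichletForm_kernel_eq hf₁ hg₁ T ψ]
  refine mul_le_mul_of_nonneg_left (sum_le_sum fun x _ => sum_le_sum fun y _ =>
    sum_le_sum fun q _ => ?_) (by norm_num)
  exact mul_le_mul_of_nonneg_right
    (sum_coupling_min_le (fun x ξ₁ ξ₂ => (hR x).nonneg ξ₁ ξ₂) (fun x ξ₁ => (hR x).fst ξ₁)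
      (fun x ξ₁ => (hR x).sum_mul_est (hπ x) ξ₁) hg₁ T x y q.1 q.2) (sq_nonneg _)

/-- **The functional form of Theorem 10 (d)**: for every `π̃₁`-admissible test function `ψ` of
`(x, ξ₁)` (mean zero, unit norm) and every bound `ρ` on the rejection probabilities of `P̃₂`,
`min{Gap_R(P̃₂), 1 − ρ} ≤ 𝓔_{P̃₁}(ψ)`.  Chain of the printed proof: Lemma 45 (c) for
`Π = P̃₂ = p̃₂ + δ ρ̃₂`, `ν = K₁` gives `min{Gap_R(P̃₂), 1 − ρ} ≤ Gap_R(P̆₂)`; the lift of `ψ` is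
`π̆`-admissible (`sum_augWeight_lift`), so `Gap_R(P̆₂) ≤ 𝓔_{P̆₂}(ψ̆)`; and
`𝓔_{P̆₂}(ψ̆) ≤ 𝓔_{P̃₁}(ψ)` (`dirichletForm_breve_lift_le`).  No irreducibility is used.
[cite: AndrieuVihola2016, Theorem 10 (d); §5 (proof of Theorem 10); Theorem 22 (d); Appendix
Lemma 45 (c)] -/
theorem min_spectralGapR_le_dirichletForm_of_coupling {f₁ : X → Ξ₁ → ℝ} {g₁ : Ξ₁ → ℝ}
    {f₂ : X → Ξ₂ → ℝ} {g₂ : Ξ₂ → ℝ} {π : X → ℝ} {T : X → X → ℝ} {r : X → Ξ₁ → Ξ₂ → ℝ}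
    (hf₁ : ∀ x ξ, 0 < f₁ x ξ) (hg₁ : ∀ ξ, 0 < g₁ ξ) (hf₂ : ∀ x ξ, 0 < f₂ x ξ)
    (hg₂ : ∀ ξ, 0 < g₂ ξ) (hg₂1 : ∑ ξ, g₂ ξ = 1) (hπ : ∀ x, 0 < π x)
    (hT : ∀ x y, 0 ≤ T x y) (hTrow : ∀ x, ∑ y, T x y ≤ 1)
    (hR : ∀ x, IsMartingaleCoupling g₁ (fun ξ => f₁ x ξ / π x) g₂ (fun ξ => f₂ x ξ / π x) (r x))
    {ρ : ℝ} (hρ : ∀ z, mhHold (proposal T g₂) (target f₂ g₂) z ≤ ρ)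
    {ψ : X × Ξ₁ → ℝ} (hψ0 : ∑ z, target f₁ g₁ z * ψ z = 0)
    (hψ1 : piInner (target f₁ g₁) ψ ψ = 1) :
    min (spectralGapR (target f₂ g₂) (kernel T f₂ g₂)) (1 - ρ) ≤
      dirichletForm (target f₁ g₁) (kernel T f₁ g₁) ψ := by
  have htpos : ∀ z : X × Ξ₂, 0 < target f₂ g₂ z := fun z => mul_pos (hg₂ z.2) (hf₂ z.1 z.2)
  have hprop : ∀ z z' : X × Ξ₂, 0 ≤ proposal T g₂ z z' :=
    fun z z' => mul_nonneg (hT _ _) (hg₂ _).le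
  have hproprow : ∀ z : X × Ξ₂, ∑ z', proposal T g₂ z z' ≤ 1 := by
    intro z
    rw [Fintype.sum_prod_type]
    show ∑ x', ∑ ξ', T z.1 x' * g₂ ξ' ≤ 1
    rw [← sum_mul_sum, hg₂1, mul_one]
    exact hTrow z.1
  have hsplit : (kernel T f₂ g₂ : Matrix (X × Ξ₂) (X × Ξ₂) ℝ) =
      (Matrix.of (mhRate (proposal T g₂) (target f₂ g₂)) : Matrix (X × Ξ₂) (X × Ξ₂) ℝ) +
        diagonal (mhHold (proposal T g₂) (target f₂ g₂)) :=
    mhKernel_eq_rate_add_diagonal _ _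
  have h45 := min_le_spectralGapR_augKernel (S := Ξ₁) (fun z => (htpos z).le)
    (p := (Matrix.of (mhRate (proposal T g₂) (target f₂ g₂)) : Matrix (X × Ξ₂) (X × Ξ₂) ℝ))
    (fun z z' => by rw [of_apply]; exact mhRate_nonneg hprop htpos z z')
    (r := mhHold (proposal T g₂) (target f₂ g₂)) (fun z => mhHold_nonneg hproprow _ z)
    (fun z => by simp only [of_apply]; exact sum_mhRate_add_mhHold _ _ z)
    (ν := condLaw r g₂) (fun z ξ₁ => div_nonneg ((hR z.1).nonneg ξ₁ z.2) (hg₂ z.2).le)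
    (sum_condLaw hR hg₂) (mhRate_detailedBalance htpos _) hρ
  rw [← hsplit] at h45
  have hw : ∀ a : (X × Ξ₂) × Ξ₁, 0 ≤ augWeight (target f₂ g₂) (condLaw r g₂) a :=
    fun a => mul_nonneg (htpos a.1).le (div_nonneg ((hR a.1.1).nonneg a.2 a.1.2) (hg₂ a.1.2).le)
  have hK : ∀ a b : (X × Ξ₂) × Ξ₁, 0 ≤ augKernel
      (Matrix.of (mhRate (proposal T g₂) (target f₂ g₂)))
      (mhHold (proposal T g₂) (target f₂ g₂)) (condLaw r g₂) a b :=
    augKernel_nonneg (fun z z' => by rw [of_apply]; exact mhRate_nonneg hprop htpos z z')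
      (fun z => mhHold_nonneg hproprow _ z)
      (fun z ξ₁ => div_nonneg ((hR z.1).nonneg ξ₁ z.2) (hg₂ z.2).le)
  have hΨ0 : ∑ a, augWeight (target f₂ g₂) (condLaw r g₂) a * (fun a => ψ (a.1.1, a.2)) a = 0 := by
    beta_reduce
    rw [sum_augWeight_lift hπ hg₂ hR ψ, hψ0]
  have hΨ1 : piInner (augWeight (target f₂ g₂) (condLaw r g₂)) (fun a => ψ (a.1.1, a.2))
      (fun a => ψ (a.1.1, a.2)) = 1 := by
    unfold piInner
    rw [sum_augWeight_lift hπ hg₂ hR (fun z => ψ z * ψ z)]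
    exact hψ1
  calc min (spectralGapR (target f₂ g₂) (kernel T f₂ g₂)) (1 - ρ)
      ≤ spectralGapR (augWeight (target f₂ g₂) (condLaw r g₂))
          (augKernel (Matrix.of (mhRate (proposal T g₂) (target f₂ g₂)))
            (mhHold (proposal T g₂) (target f₂ g₂)) (condLaw r g₂)) := h45
    _ ≤ dirichletForm (augWeight (target f₂ g₂) (condLaw r g₂))
          (augKernel (Matrix.of (mhRate (proposal T g₂) (target f₂ g₂)))
            (mhHold (proposal T g₂) (target f₂ g₂)) (condLaw r g₂)) (fun a => ψ (a.1.1, a.2)) :=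
        spectralGapR_le_dirichletForm hw hK hΨ0 hΨ1
    _ ≤ dirichletForm (target f₁ g₁) (kernel T f₁ g₁) ψ :=
        dirichletForm_breve_lift_le hf₁ hg₁ hf₂ hg₂ hπ hR ψ

/-- **Andrieu–Vihola 2016, Theorem 10 (d), finite form (coupling hypothesis)**: if the normalised
weights of `P̃₁`, `P̃₂` are coupled by a martingale coupling at every state and the rejection
probabilities of `P̃₂` are `≤ ρ`, then `min{Gap_R(P̃₂), 1 − ρ} ≤ Gap_R(P̃₁)` — "the spectral gaps
satisfy `Gap_R(P̃₁) ≥ min{Gap_R(P̃₂), 1 − ρ̃₂^*}`".  Proviso (finite bookkeeping): `X × Ξ₁` carries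
an admissible test function (on a one-point space the tree's `spectralGapR` is `sInf ∅ = 0`).
[cite: AndrieuVihola2016, Theorem 10 (d); §5 (proof via Lemma 18, Theorem 22 (d), Lemma 45)] -/
theorem spectralGapR_mono_of_coupling {f₁ : X → Ξ₁ → ℝ} {g₁ : Ξ₁ → ℝ}
    {f₂ : X → Ξ₂ → ℝ} {g₂ : Ξ₂ → ℝ} {π : X → ℝ} {T : X → X → ℝ} {r : X → Ξ₁ → Ξ₂ → ℝ}
    (hf₁ : ∀ x ξ, 0 < f₁ x ξ) (hg₁ : ∀ ξ, 0 < g₁ ξ) (hf₂ : ∀ x ξ, 0 < f₂ x ξ)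
    (hg₂ : ∀ ξ, 0 < g₂ ξ) (hg₂1 : ∑ ξ, g₂ ξ = 1) (hπ : ∀ x, 0 < π x)
    (hT : ∀ x y, 0 ≤ T x y) (hTrow : ∀ x, ∑ y, T x y ≤ 1)
    (hR : ∀ x, IsMartingaleCoupling g₁ (fun ξ => f₁ x ξ / π x) g₂ (fun ξ => f₂ x ξ / π x) (r x))
    {ρ : ℝ} (hρ : ∀ z, mhHold (proposal T g₂) (target f₂ g₂) z ≤ ρ)
    (hne : ∃ ψ : X × Ξ₁ → ℝ, ∑ z, target f₁ g₁ z * ψ z = 0 ∧ piInner (target f₁ g₁) ψ ψ = 1) :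
    min (spectralGapR (target f₂ g₂) (kernel T f₂ g₂)) (1 - ρ) ≤
      spectralGapR (target f₁ g₁) (kernel T f₁ g₁) := by
  obtain ⟨ψ₀, hψ₀⟩ := hne
  refine le_csInf ⟨_, ⟨ψ₀, hψ₀, rfl⟩⟩ ?_
  rintro _ ⟨ψ, ⟨h0, h1⟩, rfl⟩
  exact min_spectralGapR_le_dirichletForm_of_coupling hf₁ hg₁ hf₂ hg₂ hg₂1 hπ hT hTrow hR hρ h0 h1

/-- **Andrieu–Vihola 2016, Theorem 10 (d), finite form, under its PRINTED hypothesis — the convex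
order `{Q_x^{(1)}} ≤cx {Q_x^{(2)}}` of the normalised weights at every state** (Strassen's theorem,
`IsCxLE.exists_isMartingaleCoupling`, supplies the coupling state by state):
`min{Gap_R(P̃₂), 1 − ρ} ≤ Gap_R(P̃₁)` for any bound `ρ` on the rejection probabilities of `P̃₂`,
provided `X × Ξ₁` carries an admissible test function. [cite: AndrieuVihola2016, Theorem 10 (d)] -/
theorem spectralGapR_mono_of_isCxLE {f₁ : X → Ξ₁ → ℝ} {g₁ : Ξ₁ → ℝ}
    {f₂ : X → Ξ₂ → ℝ} {g₂ : Ξ₂ → ℝ} {π : X → ℝ} {T : X → X → ℝ}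
    (hf₁ : ∀ x ξ, 0 < f₁ x ξ) (hg₁ : ∀ ξ, 0 < g₁ ξ) (hf₂ : ∀ x ξ, 0 < f₂ x ξ)
    (hg₂ : ∀ ξ, 0 < g₂ ξ) (hg₂1 : ∑ ξ, g₂ ξ = 1) (hπ : ∀ x, 0 < π x)
    (hT : ∀ x y, 0 ≤ T x y) (hTrow : ∀ x, ∑ y, T x y ≤ 1)
    (hcx : ∀ x, IsCxLE g₁ (fun ξ => f₁ x ξ / π x) g₂ (fun ξ => f₂ x ξ / π x))
    {ρ : ℝ} (hρ : ∀ z, mhHold (proposal T g₂) (target f₂ g₂) z ≤ ρ)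
    (hne : ∃ ψ : X × Ξ₁ → ℝ, ∑ z, target f₁ g₁ z * ψ z = 0 ∧ piInner (target f₁ g₁) ψ ψ = 1) :
    min (spectralGapR (target f₂ g₂) (kernel T f₂ g₂)) (1 - ρ) ≤
      spectralGapR (target f₁ g₁) (kernel T f₁ g₁) := by
  choose r hr using fun x =>
    (hcx x).exists_isMartingaleCoupling (fun ξ => (hg₁ ξ).le) (fun ξ => (hg₂ ξ).le)
  exact spectralGapR_mono_of_coupling hf₁ hg₁ hf₂ hg₂ hg₂1 hπ hT hTrow hr hρ hne

end SpectralGap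

end PseudoMarginal

end Literature.Probability.MarkovChains
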